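import Mathlib.NumberTheory.DirichletCharacter.Orthogonality
import Literature.NumberTheory.LFunctions.DirichletLAtZero
import HarnessLib

/-!
# The kernel of the odd-weight residue matrix `(p - 2·(tj mod p))` is the balanced vectors (Maillet's determinant)

Family `hodge` / `numbertheory`, layer `Literature/NumberTheory/LFunctions`. A THEOREM (proved
here, no named fact).

Let `p` be an odd prime and `R(x) ∈ {1, …, p-1}` the least positive residue of `x ∈ (ℤ/pℤ)ˣ`. The
function `w(x) = p - 2 R(x)` is odd (`w(-x) = -w(x)`). **Maillet's determinant** is
`D_p = det(R(r s'))_{1 ≤ r, s ≤ (p-1)/2}` (`s s' ≡ 1`); Carlitz–Olson proved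
`D_p = ± p^{(p-3)/2} h⁻_p ≠ 0`, `h⁻_p` the relative class number of `ℚ(ζ_p)`
[cite: CarlitzOlson1955, Theorem (D_p = ± p^{(p-3)/2} h)]. Equivalently (Fourier analysis on
`(ℤ/pℤ)ˣ`): the character sums `S_ψ = ∑_u ψ(u) w(u) = -2 ∑_u u ψ(u) = -2 p B_{1,ψ}` are non-zero
for every ODD Dirichlet character `ψ` mod `p` [cite: Washington1997, Theorem 4.2; §4], which is the
tree's `LValueZero.sum_val_mul_ne_zero_of_odd` (`L(0, ψ) = -B_{1,ψ} ≠ 0`). In KERNEL FORM this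
says: **if an integer vector `(m_j)_{1 ≤ j ≤ p-1}` satisfies `∑_j m_j · w(t j) = 0` for every
`t ∈ (ℤ/pℤ)ˣ`, then `m` is balanced, `m_j = m_{p-j}`** (the odd part of `m` has all its odd
Fourier coefficients multiplied by the non-zero `S_ψ`, hence vanishes). This kernel form — with a
harmless non-zero scalar `c` — is exactly the support item `DetSupportsBalanced` (stmt-HodgeConjecture-19546) of the route
`Summits/HodgeConjecture/HodgeConjecture/Theses/CyclicUnitaryPowers.lean` (cell hodge-nonav,
ROUTE-P3v5 §1.3 step (5): rational Hodge classes on powers of a `p`-cyclic hypersurface cannot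
involve eigen-determinants), which therefore follows in one line:
`fun p _ hp c hc m h => MailletKernel.balanced_of_sum_mul_residueWeight_eq_zero hp c hc m h`.

## Contents

* `MailletKernel.((p : ℂ) - 2 * (u.val : ℂ)) = p - 2·u.val` on `ZMod p`;
* `sum_char_mul_weight_ne_zero` — `S_ψ = ∑_u ψ(u)(p - 2u) ≠ 0` for odd `ψ` (private helpers: `S_ψ = -2 ∑ u ψ(u)` for `ψ ≠ 1`; twisting `∑_t ψ(t) w(tx) = ψ(x⁻¹) S_ψ`);
* `apply_eq_apply_neg` — the `ZMod p` form: `M : ZMod p → ℂ`, `M 0 = 0`,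
  `∑_x M(x) (p - 2·(t x).val) = 0` for all `t ≠ 0` ⇒ `M(a) = M(-a)`;
* `balanced_of_sum_mul_residueWeight_eq_zero` — the `ℕ`-indexed form with the scalar `c ≠ 0`,
  verbatim the body of `DetSupportsBalanced`.

## References

* [CarlitzOlson1955] L. Carlitz, F. R. Olson, Maillet's determinant, Proc. Amer. Math. Soc. 6
  (1955) 265–269 (zbMATH 0065.02703: `D_p = ± p^{(p-3)/2} h`, hence `D_p ≠ 0`).
* [Washington1997] L. C. Washington, Introduction to Cyclotomic Fields, GTM 83, Thm 4.2 / §4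
  (`L(0,χ) = -B_{1,χ}`, `B_{1,χ} ≠ 0` for odd `χ`).
-/

noncomputable section

open Finset

namespace Literature.NumberTheory.LFunctions

namespace MailletKernel

variable {p : ℕ} [hp : Fact p.Prime]

/-- `S_ψ = ∑_u ψ(u) (p - 2u) = -2 ∑_u u ψ(u)` for a non-trivial character `ψ`. [folklore] -/
private theorem sum_char_mul_weight {ψ : DirichletCharacter ℂ p} (hψ : ψ ≠ 1) :
    ∑ u : ZMod p, ψ u * ((p : ℂ) - 2 * (u.val : ℂ)) = -2 * ∑ u : ZMod p, (u.val : ℂ) * ψ u := by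
  have h0 : ∑ u : ZMod p, ψ u = 0 := MulChar.sum_eq_zero_of_ne_one hψ
  calc ∑ u : ZMod p, ψ u * ((p : ℂ) - 2 * (u.val : ℂ))
      = (p : ℂ) * ∑ u : ZMod p, ψ u - 2 * ∑ u : ZMod p, (u.val : ℂ) * ψ u := by
        rw [Finset.mul_sum, Finset.mul_sum, ← Finset.sum_sub_distrib]
        exact Finset.sum_congr rfl fun u _ => by ring
    _ = -2 * ∑ u : ZMod p, (u.val : ℂ) * ψ u := by rw [h0]; ring

/-- A character with `ψ(-1) = -1` is not trivial. [folklore] -/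
private theorem ne_one_of_odd {ψ : DirichletCharacter ℂ p} (hψ : ψ.Odd) : ψ ≠ 1 := by
  rintro rfl
  have h1 : (1 : DirichletCharacter ℂ p) (-1) = 1 := by
    rw [show (-1 : ZMod p) = ((-1 : (ZMod p)ˣ) : ZMod p) by simp]
    exact MulChar.one_apply_coe _
  have h2 : (1 : DirichletCharacter ℂ p) (-1) = -1 := hψ
  rw [h1] at h2
  norm_num at h2

/-- **`S_ψ ≠ 0` for odd `ψ`** (`S_ψ = -2 p B_{1,ψ}`, `B_{1,ψ} ≠ 0`: the tree's
`LValueZero.sum_val_mul_ne_zero_of_odd`). [cite: Washington1997, Theorem 4.2; §4] -/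
theorem sum_char_mul_weight_ne_zero {ψ : DirichletCharacter ℂ p} (hψ : ψ.Odd) :
    ∑ u : ZMod p, ψ u * ((p : ℂ) - 2 * (u.val : ℂ)) ≠ 0 := by
  rw [sum_char_mul_weight (ne_one_of_odd hψ)]
  exact mul_ne_zero (by norm_num) (LValueZero.sum_val_mul_ne_zero_of_odd hψ)

/-- Twisting: for `x ≠ 0`, `∑_t ψ(t) w(t x) = ψ(x⁻¹) S_ψ`. [folklore] -/
private theorem sum_char_mul_weight_mul (ψ : DirichletCharacter ℂ p) {x : ZMod p} (hx : x ≠ 0) :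
    ∑ t : ZMod p, ψ t * ((p : ℂ) - 2 * ((t * x).val : ℂ)) = ψ x⁻¹ * ∑ u : ZMod p, ψ u * ((p : ℂ) - 2 * (u.val : ℂ)) := by
  rw [Finset.mul_sum]
  refine Fintype.sum_bijective (fun t : ZMod p => t * x) (mulRight_bijective₀ x hx) _ _ fun t => ?_
  have hψ : ψ x⁻¹ * ψ (t * x) = ψ t := by
    rw [← map_mul, mul_comm t x, ← mul_assoc, inv_mul_cancel₀ hx, one_mul]
  rw [← hψ]
  ring

/-- **The `ZMod p` form.** If `M : ZMod p → ℂ` vanishes at `0` and `∑_x M(x) w(t x) = 0` for every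
`t ≠ 0`, then `M(a) = M(-a)` for all `a`. (Fourier analysis on `(ℤ/pℤ)ˣ`: the odd Fourier
coefficients of `M` are killed by `S_ψ ≠ 0`, the even ones do not see `M - M∘neg`; orthogonality
of characters.) [cite: CarlitzOlson1955, Theorem (D_p ≠ 0), kernel form] -/
theorem apply_eq_apply_neg (M : ZMod p → ℂ) (hM0 : M 0 = 0)
    (h : ∀ t : ZMod p, t ≠ 0 → ∑ x : ZMod p, M x * ((p : ℂ) - 2 * ((t * x).val : ℂ)) = 0) (a : ZMod p) :
    M a = M (-a) := by
  -- (★) the twisted Fourier coefficients of `M` vanish at odd characters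
  have hA : ∀ ψ : DirichletCharacter ℂ p, ψ.Odd → ∑ x : ZMod p, M x * ψ x⁻¹ = 0 := by
    intro ψ hψ
    have hS := sum_char_mul_weight_ne_zero hψ
    have h1 : ∑ t : ZMod p, ψ t * ∑ x : ZMod p, M x * ((p : ℂ) - 2 * ((t * x).val : ℂ)) = 0 := by
      refine Finset.sum_eq_zero fun t _ => ?_
      by_cases ht : t = 0
      · rw [ht, MulChar.map_zero, zero_mul]
      · rw [h t ht, mul_zero]
    have h2 : ∑ t : ZMod p, ψ t * ∑ x : ZMod p, M x * ((p : ℂ) - 2 * ((t * x).val : ℂ)) =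
        (∑ u : ZMod p, ψ u * ((p : ℂ) - 2 * (u.val : ℂ))) * ∑ x : ZMod p, M x * ψ x⁻¹ := by
      calc ∑ t : ZMod p, ψ t * ∑ x : ZMod p, M x * ((p : ℂ) - 2 * ((t * x).val : ℂ))
          = ∑ x : ZMod p, M x * ∑ t : ZMod p, ψ t * ((p : ℂ) - 2 * ((t * x).val : ℂ)) := by
            simp_rw [Finset.mul_sum]
            rw [Finset.sum_comm]
            exact Finset.sum_congr rfl fun x _ => Finset.sum_congr rfl fun t _ => by ring
        _ = ∑ x : ZMod p, M x * (ψ x⁻¹ * ∑ u : ZMod p, ψ u * ((p : ℂ) - 2 * (u.val : ℂ))) := by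
            refine Finset.sum_congr rfl fun x _ => ?_
            by_cases hx : x = 0
            · rw [hx, hM0, zero_mul, zero_mul]
            · rw [sum_char_mul_weight_mul ψ hx]
        _ = (∑ u : ZMod p, ψ u * ((p : ℂ) - 2 * (u.val : ℂ))) * ∑ x : ZMod p, M x * ψ x⁻¹ := by
            rw [Finset.mul_sum]
            exact Finset.sum_congr rfl fun x _ => by ring
    rw [h2] at h1
    exact (mul_eq_zero.mp h1).resolve_left hS
  -- all twisted Fourier coefficients of `N := M - M ∘ neg` vanish
  have hB : ∀ ψ : DirichletCharacter ℂ p, ∑ x : ZMod p, (M x - M (-x)) * ψ x⁻¹ = 0 := by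
    intro ψ
    have hre : ∑ x : ZMod p, M (-x) * ψ x⁻¹ = ψ (-1) * ∑ x : ZMod p, M x * ψ x⁻¹ := by
      rw [Finset.mul_sum]
      refine Fintype.sum_equiv (Equiv.neg (ZMod p)) _ _ fun x => ?_
      simp only [Equiv.neg_apply]
      have h1 : ψ (-1) ^ 2 = 1 := by rw [← map_pow, neg_one_sq, map_one]
      rw [inv_neg, show -x⁻¹ = (-1) * x⁻¹ by ring, map_mul,
        show ψ (-1) * (M (-x) * (ψ (-1) * ψ x⁻¹)) = M (-x) * ψ x⁻¹ * ψ (-1) ^ 2 by ring, h1, mul_one]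
    have hsplit : ∑ x : ZMod p, (M x - M (-x)) * ψ x⁻¹ =
        ∑ x : ZMod p, M x * ψ x⁻¹ - ∑ x : ZMod p, M (-x) * ψ x⁻¹ := by
      rw [← Finset.sum_sub_distrib]
      exact Finset.sum_congr rfl fun x _ => by ring
    rw [hsplit, hre]
    rcases ψ.even_or_odd with he | ho
    · have he' : ψ (-1) = 1 := he
      rw [he', one_mul, sub_self]
    · rw [hA ψ ho, mul_zero, sub_self]
  -- Fourier inversion at the unit `a`
  by_cases ha : a = 0
  · rw [ha, neg_zero]
  have key : ∑ ψ : DirichletCharacter ℂ p, ψ a * ∑ x : ZMod p, (M x - M (-x)) * ψ x⁻¹ = 0 :=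
    Finset.sum_eq_zero fun ψ _ => by rw [hB ψ, mul_zero]
  have hswap : ∑ ψ : DirichletCharacter ℂ p, ψ a * ∑ x : ZMod p, (M x - M (-x)) * ψ x⁻¹ =
      ∑ x : ZMod p, (M x - M (-x)) * ∑ ψ : DirichletCharacter ℂ p, ψ x⁻¹ * ψ a := by
    simp_rw [Finset.mul_sum]
    rw [Finset.sum_comm]
    exact Finset.sum_congr rfl fun x _ => Finset.sum_congr rfl fun ψ _ => by ring
  have inner : ∀ x : ZMod p, (M x - M (-x)) * ∑ ψ : DirichletCharacter ℂ p, ψ x⁻¹ * ψ a =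
      if x = a then (M a - M (-a)) * (p.totient : ℂ) else 0 := by
    intro x
    by_cases hx : x = 0
    · rw [if_neg (by rw [hx]; exact Ne.symm ha), hx, neg_zero, hM0, sub_self, zero_mul]
    · rw [DirichletCharacter.sum_char_inv_mul_char_eq ℂ (Ne.isUnit hx) a]
      by_cases hxa : x = a
      · rw [if_pos hxa, if_pos hxa, hxa]
      · rw [if_neg hxa, if_neg hxa, mul_zero]
  rw [hswap, Finset.sum_congr rfl fun x _ => inner x, Finset.sum_ite_eq' Finset.univ a,
    if_pos (Finset.mem_univ a)] at key
  have htot : (p.totient : ℂ) ≠ 0 := by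
    exact_mod_cast (Nat.totient_pos.mpr hp.out.pos).ne'
  exact sub_eq_zero.mp ((mul_eq_zero.mp key).resolve_right htot)

omit hp in
/-- **Kernel form of Maillet's determinant (the route item `DetSupportsBalanced`, verbatim body).**
For a prime `p`, a non-zero integer `c` and `m : ℕ → ℤ`: if
`∑_{j=1}^{p-1} m_j · c · (p - 2·(t j mod p)) = 0` for every `1 ≤ t ≤ p-1`, then `m_j = m_{p-j}`
for `1 ≤ j ≤ p-1`. [cite: CarlitzOlson1955, Theorem (D_p = ± p^{(p-3)/2} h ≠ 0), kernel form]
[cite: Washington1997, Theorem 4.2; §4 (B_{1,χ} ≠ 0 for odd χ)] -/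
theorem balanced_of_sum_mul_residueWeight_eq_zero (hprime : p.Prime) (c : ℤ) (hc : c ≠ 0)
    (m : ℕ → ℤ)
    (h : ∀ t ∈ Finset.Ico 1 p,
      ∑ j ∈ Finset.Ico 1 p, m j * (c * ((p : ℤ) - 2 * ((t * j % p : ℕ) : ℤ))) = 0) :
    ∀ j ∈ Finset.Ico 1 p, m j = m (p - j) := by
  haveI : Fact p.Prime := ⟨hprime⟩
  have hp1 : 1 < p := hprime.one_lt
  -- the function on `ZMod p`
  let M : ZMod p → ℂ := fun x => if x = 0 then 0 else (m x.val : ℂ)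
  have hM0 : M 0 = 0 := by simp [M]
  have hMval : ∀ j ∈ Finset.Ico 1 p, M (j : ZMod p) = (m j : ℂ) := by
    intro j hj
    rw [Finset.mem_Ico] at hj
    have hj0 : (j : ZMod p) ≠ 0 := by
      rw [Ne, ZMod.natCast_eq_zero_iff]
      exact Nat.not_dvd_of_pos_of_lt hj.1 hj.2
    simp only [M, if_neg hj0, ZMod.val_natCast_of_lt hj.2]
  -- sums over `ZMod p` of functions vanishing at `0` are sums over `Ico 1 p`
  have hsum : ∀ F : ZMod p → ℂ, F 0 = 0 → ∑ x : ZMod p, F x = ∑ j ∈ Finset.Ico 1 p, F (j : ZMod p) := by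
    intro F hF0
    have h1 : ∑ x : ZMod p, F x = ∑ j ∈ Finset.range p, F (j : ZMod p) := by
      symm
      refine Finset.sum_nbij' (fun j : ℕ => (j : ZMod p)) (fun x : ZMod p => x.val) ?_ ?_ ?_ ?_ ?_
      · intro j _; exact Finset.mem_univ _
      · intro x _; exact Finset.mem_range.mpr (ZMod.val_lt x)
      · intro j hj; exact ZMod.val_natCast_of_lt (Finset.mem_range.mp hj)
      · intro x _; exact ZMod.natCast_zmod_val x
      · intro j _; rfl
    rw [h1, Finset.range_eq_Ico, ← Finset.sum_Ico_consecutive _ (Nat.zero_le 1) hp1.le,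
      Finset.sum_Ico_succ_top (Nat.le_refl 0), Finset.Ico_self, Finset.sum_empty, zero_add,
      Nat.cast_zero, hF0, zero_add]
  -- transfer of the hypothesis
  have hH : ∀ t : ZMod p, t ≠ 0 → ∑ x : ZMod p, M x * ((p : ℂ) - 2 * ((t * x).val : ℂ)) = 0 := by
    intro t ht
    have htval : t.val ∈ Finset.Ico 1 p := by
      rw [Finset.mem_Ico]
      exact ⟨Nat.pos_of_ne_zero fun h0 => ht ((ZMod.val_eq_zero t).mp h0), ZMod.val_lt t⟩
    have h0 := h t.val htval
    have h1 : ∑ j ∈ Finset.Ico 1 p, m j * ((p : ℤ) - 2 * ((t.val * j % p : ℕ) : ℤ)) = 0 := by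
      have hc0 : c * ∑ j ∈ Finset.Ico 1 p, m j * ((p : ℤ) - 2 * ((t.val * j % p : ℕ) : ℤ)) = 0 := by
        rw [Finset.mul_sum, ← h0]
        exact Finset.sum_congr rfl fun j _ => by ring
      exact (mul_eq_zero.mp hc0).resolve_left hc
    have h2 : ∑ j ∈ Finset.Ico 1 p, (m j : ℂ) * ((p : ℂ) - 2 * ((t.val * j % p : ℕ) : ℂ)) = 0 := by
      have h3 := congrArg (fun z : ℤ => (z : ℂ)) h1
      push_cast at h3
      exact h3
    have hF0 : M 0 * ((p : ℂ) - 2 * ((t * 0).val : ℂ)) = 0 := by rw [hM0, zero_mul]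
    rw [hsum (fun x => M x * ((p : ℂ) - 2 * ((t * x).val : ℂ))) hF0, ← h2]
    refine Finset.sum_congr rfl fun j hj => ?_
    rw [hMval j hj, ZMod.val_mul, ZMod.val_natCast_of_lt (Finset.mem_Ico.mp hj).2]
  -- conclusion
  intro j hj
  have hj' := Finset.mem_Ico.mp hj
  have hpj : p - j ∈ Finset.Ico 1 p := by
    rw [Finset.mem_Ico]; omega
  have hneg : -((j : ℕ) : ZMod p) = ((p - j : ℕ) : ZMod p) := by
    rw [Nat.cast_sub hj'.2.le, ZMod.natCast_self, zero_sub]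
  have hcore := apply_eq_apply_neg M hM0 hH (j : ZMod p)
  rw [hneg, hMval j hj, hMval (p - j) hpj] at hcore
  exact_mod_cast hcore

end MailletKernel

end Literature.NumberTheory.LFunctions
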